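import Summits.AtomisticToContinuum.BoseEinsteinCondensation.Theses.BECFeynmanVortexArea
import Summits.AtomisticToContinuum.BoseEinsteinCondensation.Theorems.BECFeynmanVortexAreaTorusGroundStateClose
import Summits.AtomisticToContinuum.BoseEinsteinCondensation.Theorems.BECGroundStateSOSPeriodicIRBoundWFVariational
import Summits.AtomisticToContinuum.BoseEinsteinCondensation.Theorems.BECGroundStateSOSPeriodicIRBoundWFRegularity
import Literature.MathematicalPhysics.QuantumManyBody.TorusFockLayer
import HarnessLib

/-!
# Birth skeleton for crux `NearConvexity` (stmt-AtomisticToContinuum-12604) — line `condensate-koopmans`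

Route `route-AtomisticToContinuum-BECFeynmanVortexArea` (rank-3 crux); crux decl
`Summit.AtomisticToContinuum.BoseEinsteinCondensation.Theses.BECFeynmanVortexArea.NearConvexity`
(near-convexity of the periodic ground-state energy in `N` at fixed side:
`2E₀(N,L_N) ≤ E₀(N+1,L_N) + E₀(N-1,L_N) + κ(2π/L_N)²` eventually in `N`, `L_N = (N/ρ)^{1/3}`, for every
bounded repulsive finite-range `v`, every `κ > 0`, all small `ρ`), concluded BY NAME by
`NearConvexity_of` (§4), a closed term over the FOUR registered stubs of §3 (sorries only inside `stub_*`).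

## The line (condensate particle transfer + Koopmans potentials)

Write `a₀ = a(φ₀)`, `a₀† = a†(φ₀)` for the first-quantised annihilation / creation operators of the
constant mode `φ₀ = L^{-3/2}` (tree: `BoseGas.modeAn`, `BoseGas.modeCr` of `TorusFockLayer.lean`), `Φ_M` for
the positive torus ground state of `M` bosons (exists: `TorusGroundState`, landed as
`Theorems.torusGroundState_proved`), `𝓔 = WF.qform` (unnormalised energy form), `‖·‖² = WF.normSq`,
`n₀(Φ) = ‖a₀Φ‖²`, and `K(Φ) = ⟨a₀Φ, [a₀,V]Φ⟩ = ⟨a₀Φ, a₀(WΦ)⟩ ≥ 0` (`removalGain`; `W(x₀;Y) = Σ_j v^per(x₀-y_j)`),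
so that `μ_K⁻(Φ) := K(Φ)/‖a₀Φ‖²` is the **Koopmans removal potential** (mean repulsion felt by a
condensate particle) and `μ_K⁺(Φ) := (𝓔[a₀†Φ] - E‖a₀†Φ‖²)/‖a₀†Φ‖²` the Koopmans addition potential.
Two `N`-body TRIAL STATES are built by moving one condensate particle: `a₀Φ_{N+1}` and `a₀†Φ_{N-1}`.

* stub 1 `RemovalIdentity` (M–L, provable now): `𝓔[a₀Φ] + K(Φ) = E₀(M)·‖a₀Φ‖²` for a positive ground state
  `Φ` of `M = n+1` bosons, and `‖a₀Φ‖² ≠ 0` — the weak Euler–Lagrange equation of the minimiser tested against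
  `a₀†a₀Φ` (tree: `WF.Pkg.Polar` at `δ = 0`, `WF.Pkg.PotCross2` at `k = 0`, kinetic polarisation).
* stub 2 `AdditionBound` (L, provable now): `‖a₀Φ‖² ≤ ‖a₀†Φ‖²` (CCR) and
  `𝓔[a₀†Φ] ≤ E₀(M)‖a₀†Φ‖² + K(Φ) + 2M‖v‖₁/L³` — the double-commutator conversion
  `μ_K⁺ (n₀+1) = n₀ μ_K⁻ + ⟨[[a₀,V],a₀†]⟩`, `0 ≤ ⟨[[a₀,V],a₀†]⟩ = L⁻³(‖v‖₁M + Σ_q v̂(q)n_q) ≤ 2M‖v‖₁/L³`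
  (tree: `WF.Pkg.HeartKin2`/`HeartKin` at `p = 0`, `WF.Pkg.PotCreate3`, `WF.Pkg.PotToolkit`, stub 1).
* stub 3 `KoopmansMonotone` (the HEART, open): along `L = L_N`, `ρ < ρ₀(v,κ)`, eventually:
  `μ_K⁻(Φ_{N-1}) ≤ μ_K⁻(Φ_{N+1}) + κ(2π/L)²` — the Koopmans REMOVAL potential does not drop by more than
  `o(L⁻²)` over two steps in the particle number (Bogoliubov: it rises by `16πa/L³`).
* stub 4 `WeakCondensation` (open, strictly weaker than BEC): `2(N-1)‖v‖₁/L³ ≤ κ(2π/L)²·‖a₀†Φ_{N-1}‖²`, i.e.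
  `n₀(Φ_{N-1}) + 1 ≥ (N-1)‖v‖₁/(π²κ L_N) ≍ ρ^{1/3}N^{2/3}` — sub-extensive condensation at exponent `2/3`.

Assembly (§4, sorry-free): variational principle for the two core functions `a₀Φ_{N+1}`, `a₀†Φ_{N-1}`
(tree `WF.groundStateEnergy_mul_normSq_le`, `WF.isCore_modeAn/modeCr`), stub 1 ⇒ `E₀(N) + μ_K⁻(Φ_{N+1}) ≤ E₀(N+1)`;
stub 2 ⇒ `E₀(N) ≤ E₀(N-1) + K(Φ_{N-1})/‖a₀†Φ_{N-1}‖² + 2(N-1)‖v‖₁/(L³‖a₀†Φ_{N-1}‖²)`; CCR + stub 3 + stub 4 bound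
the last two terms by `μ_K⁻(Φ_{N+1}) + κ(2π/L)²`; add and cancel the finite `μ_K⁻(Φ_{N+1}) ≤ E₀(N+1) < ∞`.

Indexing: the stubs 3–4 and the assembly write `N = n + 2` (`n → ∞`), so that `N - 1 = n + 1`, `N + 1 = n + 3`
are successors and `a₀`, `a₀†`, `K` typecheck without casts.

Disproof used: none on file for this crux (no `Cruxes/NearConvexity/Disproof.lean` at registration);
negatives index: no BEC negative touches second differences in `N` (SwapJensen 3980 unrelated).
-/

noncomputable section

open scoped BigOperators ENNReal NNReal
open Filter MeasureTheory

namespace Summit.AtomisticToContinuum.BoseEinsteinCondensation.Cruxes.NearConvexity.Birth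

open Literature.MathematicalPhysics.QuantumManyBody.BoseGas
open Summit.AtomisticToContinuum.BoseEinsteinCondensation.Theses.BECFeynmanVortexArea
  (NearConvexity TorusGroundState)
open Summit.AtomisticToContinuum.BoseEinsteinCondensation.Cruxes.PeriodicIRBound.LinearPhFloorWagner.WF
  (qform normSq IsCore isCore_trialState groundStateEnergy_mul_normSq_le isCore_modeAn isCore_modeCr
    normSq_lt_top)

-- BEGIN DEFS

variable {n : ℕ}

/-! ## §1 Objects of the line -/

/-- `a₀Φ`: annihilation of the constant mode `φ₀ = L^{-3/2}` (`planeWaveMode L 0`) in first quantisation,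
`(a₀Φ)(Y) = √(n+1) ∫_cell conj(φ₀) Φ(x, Y) dx` (tree `modeAn`). [cite: LSSY2005, App. A (A.13)] -/
abbrev condAn (L : ℝ) (Φ : Config (n + 1) → ℂ) : Config n → ℂ :=
  modeAn L (planeWaveMode L 0) Φ

/-- `a₀†Φ`: creation of the constant mode in first quantisation (tree `modeCr`). [cite: LSSY2005, App. A (A.14)] -/
abbrev condCr (L : ℝ) (Φ : Config n → ℂ) : Config (n + 1) → ℂ :=
  modeCr (planeWaveMode L 0) Φ

/-- The field felt by particle `0`: `W(x₀; x₁…x_n) = Σ_{j ≥ 1} v^per(x₀ - x_j)`, so that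
`V_{n+1}(x₀ :: Y) = V_n(Y) + W(x₀; Y)` and `[a₀, V]Φ = a₀(WΦ)`. [folklore] -/
def headField (v : ℝ → ℝ≥0∞) (L : ℝ) (X : Config (n + 1)) : ℝ≥0∞ :=
  ∑ j : Fin n, periodizedPotential v L (X 0 - X j.succ)

/-- `[a₀, V]Φ = a₀(W·Φ)` (an `n`-body function). [folklore] -/
def condAnCom (v : ℝ → ℝ≥0∞) (L : ℝ) (Φ : Config (n + 1) → ℂ) : Config n → ℂ :=
  condAn L fun X => ((headField v L X).toReal : ℂ) * Φ X

/-- The **removal gain** `K(Φ) = ⟨a₀Φ, [a₀,V]Φ⟩`, written for a POSITIVE `Φ` (then `a₀Φ ≥ 0` and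
`a₀(WΦ) ≥ 0` pointwise) as the lower integral of the product of moduli; `K(Φ) = E₀‖a₀Φ‖² - 𝓔[a₀Φ]` for a
ground state (stub 1). [folklore] -/
def removalGain (v : ℝ → ℝ≥0∞) (L : ℝ) (Φ : Config (n + 1) → ℂ) : ℝ≥0∞ :=
  ∫⁻ Y in cellN n L, (‖condAn L Φ Y‖₊ : ℝ≥0∞) * (‖condAnCom v L Φ Y‖₊ : ℝ≥0∞)

/-- The **Koopmans removal potential** `μ_K⁻(Φ) = K(Φ)/‖a₀Φ‖² = ⟨a₀Φ,[a₀,V]Φ⟩/n₀(Φ)`: the mean repulsion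
felt by a condensate particle (`≈ 8πa(M-1)/L³` at Bogoliubov level). [folklore] -/
def koopmansRemoval (v : ℝ → ℝ≥0∞) (L : ℝ) (Φ : Config (n + 1) → ℂ) : ℝ≥0∞ :=
  removalGain v L Φ / normSq L (condAn L Φ)

/-- A positive ground state on the torus: attains `E₀^per(M,L) < ∞` in the periodic `C¹` Bose class and is
real, strictly positive (the conclusion of `TorusGroundState`, translation invariance dropped). [folklore] -/
structure IsPosGround (v : ℝ → ℝ≥0∞) {M : ℕ} {L : ℝ} (Φ : PeriodicTrialState M L) : Prop where
  /-- `Φ` attains the periodic ground-state energy. -/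
  energy_eq : periodicEnergy v Φ = periodicGroundStateEnergy v M L
  /-- which is finite. -/
  ne_top : periodicGroundStateEnergy v M L ≠ ⊤
  /-- `Φ` is real and strictly positive. -/
  pos : ∀ X, 0 < (Φ.ψ X).re ∧ (Φ.ψ X).im = 0

/-! ## §2 Statements of the stubs -/

/-- **Stub 1 — ground-state representation of the lowered state.** For a bounded repulsive finite-range `v`,
`L > 0` and a positive ground state `Φ` of `n+1` bosons: `𝓔[a₀Φ] + K(Φ) = E₀(n+1,L)·‖a₀Φ‖²` and `‖a₀Φ‖² ≠ 0`
(i.e. `E₀(n) ≤ E₀(n+1) - μ_K⁻(Φ)`: the true removal energy dominates the Koopmans one). Proof plan: weak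
Euler–Lagrange equation of the minimiser `Φ` (symmetrise the test function) tested against `a₀†a₀Φ`,
adjointness `integral_conj_modeCr_mul`, `[a₀,V] = a₀W`, `[T,a₀] = 0`; positivity gives `‖a₀Φ‖² > 0`.
A statement of the proof plan (provable now, M–L in Lean). -/
def RemovalIdentity : Prop :=
  ∀ v : ℝ → ℝ≥0∞, IsRepulsiveFiniteRange v → (∃ M : NNReal, ∀ r, v r ≤ M) →
    ∀ (n : ℕ) (L : ℝ), 0 < L → ∀ Φ : PeriodicTrialState (n + 1) L, IsPosGround v Φ →
      qform v L (condAn L Φ.ψ) + removalGain v L Φ.ψ =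
          periodicGroundStateEnergy v (n + 1) L * normSq L (condAn L Φ.ψ) ∧
        normSq L (condAn L Φ.ψ) ≠ 0

/-- **Stub 2 — energy of the raised state (double-commutator conversion).** For a bounded repulsive
finite-range `v`, `L > 0` and a positive ground state `Φ` of `n+1` bosons: `‖a₀Φ‖² ≤ ‖a₀†Φ‖²` (CCR
`‖a₀†Φ‖² = ‖Φ‖² + ‖a₀Φ‖²`) and `𝓔[a₀†Φ] ≤ E₀(n+1,L)‖a₀†Φ‖² + K(Φ) + 2(n+1)‖v‖₁/L³`, `‖v‖₁ = ∫ v(|x|)dx` —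
exactly `𝓔[a₀†Φ] = E₀(n₀+1) + K + D`, `D = ⟨[[a₀,V],a₀†]⟩_Φ = L⁻³(‖v‖₁(n+1) + Σ_q v̂(q) n_q) ∈ [0, 2(n+1)‖v‖₁/L³]`
(direct + exchange, `|v̂(q)| ≤ ‖v‖₁`). Proof plan: kinetic identities `WF.Pkg.HeartKin2`/`HeartKin` at `p = 0`,
`WF.Pkg.PotCreate3` + `PotToolkit` at `k = 0`, and stub 1 for `𝓔[a₀Φ]`. Provable now (L in Lean). -/
def AdditionBound : Prop :=
  ∀ v : ℝ → ℝ≥0∞, IsRepulsiveFiniteRange v → (∃ M : NNReal, ∀ r, v r ≤ M) →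
    ∀ (n : ℕ) (L : ℝ), 0 < L → ∀ Φ : PeriodicTrialState (n + 1) L, IsPosGround v Φ →
      normSq L (condAn L Φ.ψ) ≤ normSq L (condCr L Φ.ψ) ∧
        qform v L (condCr L Φ.ψ) ≤
          periodicGroundStateEnergy v (n + 1) L * normSq L (condCr L Φ.ψ) + removalGain v L Φ.ψ +
            ENNReal.ofReal (2 * (n + 1) * (∫⁻ x : Space, v ‖x‖).toReal / L ^ 3)

/-- **Stub 3 — Koopmans removal potential nearly non-decreasing over two steps (the heart).** For a bounded
repulsive finite-range `v` and `κ > 0` there is `ρ₀ > 0` such that for `0 < ρ < ρ₀`, eventually in `n`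
(`N = n+2`, `L = L_N = (N/ρ)^{1/3}`), for all positive ground states `Φm` of `N-1` and `Φp` of `N+1` bosons at
side `L`: `μ_K⁻(Φm) ≤ μ_K⁻(Φp) + κ(2π/L)²`. Bogoliubov: `μ_K⁻(Φ_M) = 8πa(M-1)/L³(1 + O(√(ρa³)))` rises by
`16πa/L³`; why it might fail: a non-smooth `M`-dependence of the condensate's correlation hole (level
crossing / commensurability at finite `L`) of size `≥ κ(2π/L)²`. One-sided and about an explicit positive
functional of the ground STATE — not the crux reworded (it neither implies nor follows from it without
stubs 1, 2, 4). Open; no printed result. -/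
def KoopmansMonotone : Prop :=
  ∀ v : ℝ → ℝ≥0∞, IsRepulsiveFiniteRange v → (∃ M : NNReal, ∀ r, v r ≤ M) →
    ∀ κ : ℝ, 0 < κ → ∃ ρ₀ : ℝ, 0 < ρ₀ ∧ ∀ ρ : ℝ, 0 < ρ → ρ < ρ₀ → ∀ᶠ n : ℕ in atTop,
      ∀ (Φm : PeriodicTrialState (n + 1) (sideLength ρ (n + 2)))
        (Φp : PeriodicTrialState (n + 3) (sideLength ρ (n + 2))),
        IsPosGround v Φm → IsPosGround v Φp →
          koopmansRemoval v (sideLength ρ (n + 2)) Φm.ψ ≤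
            koopmansRemoval v (sideLength ρ (n + 2)) Φp.ψ +
              ENNReal.ofReal (κ * (2 * Real.pi / sideLength ρ (n + 2)) ^ 2)

/-- **Stub 4 — sub-extensive condensation at exponent 2/3 (strictly weaker than BEC).** For a bounded
repulsive finite-range `v` and `κ > 0` there is `ρ₀ > 0` such that for `0 < ρ < ρ₀`, eventually in `n`
(`N = n+2`, `L = L_N`), every positive ground state `Φ` of `N-1` bosons at side `L` has
`2(N-1)‖v‖₁/L³ ≤ κ(2π/L)²·‖a₀†Φ‖²`; since `‖a₀†Φ‖² = n₀(Φ) + 1` (CCR) this reads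
`n₀(Φ_{N-1}) + 1 ≥ (N-1)‖v‖₁/(π²κ L_N) ≍ ‖v‖₁ρ^{1/3}N^{2/3}/(π²κ)`: the ground state keeps `≫ N^{2/3}` particles in
the zero mode. It is the price `D/(n₀+1)` of the double commutator in stub 2. Why it might fail: nothing
rigorous is known about `n₀` in this thermodynamic regime (BEC itself is `n₀ ≥ cN`); open. -/
def WeakCondensation : Prop :=
  ∀ v : ℝ → ℝ≥0∞, IsRepulsiveFiniteRange v → (∃ M : NNReal, ∀ r, v r ≤ M) →
    ∀ κ : ℝ, 0 < κ → ∃ ρ₀ : ℝ, 0 < ρ₀ ∧ ∀ ρ : ℝ, 0 < ρ → ρ < ρ₀ → ∀ᶠ n : ℕ in atTop,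
      ∀ Φ : PeriodicTrialState (n + 1) (sideLength ρ (n + 2)), IsPosGround v Φ →
        ENNReal.ofReal (2 * (n + 1) * (∫⁻ x : Space, v ‖x‖).toReal / sideLength ρ (n + 2) ^ 3) ≤
          ENNReal.ofReal (κ * (2 * Real.pi / sideLength ρ (n + 2)) ^ 2) *
            normSq (sideLength ρ (n + 2)) (condCr (sideLength ρ (n + 2)) Φ.ψ)

-- END DEFS

/-! ## §3 The registered stubs -/

/-- Stub 1 (provable now, M–L): ground-state representation of the lowered state. -/
theorem stub_removalIdentity : RemovalIdentity := by
  sorry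

/-- Stub 2 (provable now, L): energy of the raised state, double-commutator conversion. -/
theorem stub_additionBound : AdditionBound := by
  sorry

/-- Stub 3 (the heart, open): Koopmans removal potential nearly non-decreasing over two steps. -/
theorem stub_koopmansMonotone : KoopmansMonotone := by
  sorry

/-- Stub 4 (open, weaker than BEC): sub-extensive condensation at exponent `2/3`. -/
theorem stub_weakCondensation : WeakCondensation := by
  sorry

/-! ## §4 The composition: the four stubs conclude the crux BY NAME -/

/-- **`RemovalIdentity → AdditionBound → KoopmansMonotone → WeakCondensation → NearConvexity`**, as a closed
term over the four registered stubs (the skeleton audit admits no other hypotheses; the first four `have`s are the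
only places the stubs enter). Particle-transfer trial states `a₀Φ_{N+1}`, `a₀†Φ_{N-1}` (core functions by
`WF.isCore_modeAn/modeCr`), the unnormalised variational principle `WF.groundStateEnergy_mul_normSq_le`, the
positive ground states of `Theorems.torusGroundState_proved`, and `ℝ≥0∞` bookkeeping. [folklore] -/
theorem NearConvexity_of : NearConvexity := by
  have h₁ : RemovalIdentity := stub_removalIdentity
  have h₂ : AdditionBound := stub_additionBound
  have h₃ : KoopmansMonotone := stub_koopmansMonotone
  have h₄ : WeakCondensation := stub_weakCondensation
  intro v hv hb κ hκ
  have hκ2 : 0 < κ / 2 := half_pos hκ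
  obtain ⟨ρ₃, hρ₃, H₃⟩ := h₃ v hv hb (κ / 2) hκ2
  obtain ⟨ρ₄, hρ₄, H₄⟩ := h₄ v hv hb (κ / 2) hκ2
  refine ⟨min ρ₃ ρ₄, lt_min hρ₃ hρ₄, fun ρ hρ hρlt => ?_⟩
  have E₃ := H₃ ρ hρ (hρlt.trans_le (min_le_left _ _))
  have E₄ := H₄ ρ hρ (hρlt.trans_le (min_le_right _ _))
  rw [Filter.eventually_atTop] at E₃ E₄
  obtain ⟨n₃, hn₃⟩ := E₃
  obtain ⟨n₄, hn₄⟩ := E₄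
  refine Filter.eventually_atTop.2 ⟨max n₃ n₄ + 2, fun N hN => ?_⟩
  obtain ⟨n, rfl⟩ : ∃ n, N = n + 2 := ⟨N - 2, by omega⟩
  have hn3 : n₃ ≤ n := by omega
  have hn4 : n₄ ≤ n := by omega
  -- the common box `L = L_N`, `N = n + 2`
  set L : ℝ := sideLength ρ (n + 2) with hL_def
  have hL : 0 < L := by
    rw [hL_def, sideLength]
    exact Real.rpow_pos_of_pos (div_pos (by positivity) hρ) _
  -- positive ground states with `N - 1 = n + 1` and `N + 1 = n + 3` particles
  obtain ⟨Φm, hΦm_e, hΦm_t, hΦm_p, -⟩ :=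
    Summit.AtomisticToContinuum.BoseEinsteinCondensation.Theorems.torusGroundState_proved v hv hb (n + 1) L hL
  obtain ⟨Φp, hΦp_e, hΦp_t, hΦp_p, -⟩ :=
    Summit.AtomisticToContinuum.BoseEinsteinCondensation.Theorems.torusGroundState_proved v hv hb (n + 3) L hL
  have gm : IsPosGround v Φm := ⟨hΦm_e, hΦm_t, hΦm_p⟩
  have gp : IsPosGround v Φp := ⟨hΦp_e, hΦp_t, hΦp_p⟩
  -- names
  set E1 : ℝ≥0∞ := periodicGroundStateEnergy v (n + 1) L with hE1
  set E2 : ℝ≥0∞ := periodicGroundStateEnergy v (n + 2) L with hE2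
  set E3 : ℝ≥0∞ := periodicGroundStateEnergy v (n + 3) L with hE3
  set A : ℝ≥0∞ := normSq L (condAn L Φp.ψ) with hA
  set Kp : ℝ≥0∞ := removalGain v L Φp.ψ with hKp
  set Am : ℝ≥0∞ := normSq L (condAn L Φm.ψ) with hAm
  set C : ℝ≥0∞ := normSq L (condCr L Φm.ψ) with hC
  set Km : ℝ≥0∞ := removalGain v L Φm.ψ with hKm
  set Dn : ℝ≥0∞ := ENNReal.ofReal (2 * (n + 1) * (∫⁻ x : Space, v ‖x‖).toReal / L ^ 3) with hDn
  set τ : ℝ≥0∞ := ENNReal.ofReal (κ / 2 * (2 * Real.pi / L) ^ 2) with hτ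
  -- core-ness and finiteness of the two trial functions
  have hcoreA : IsCore L (condAn L Φp.ψ) := isCore_modeAn hL 0 (isCore_trialState Φp)
  have hcoreC : IsCore L (condCr L Φm.ψ) := isCore_modeCr hL 0 (isCore_trialState Φm)
  have hAtop : A ≠ ⊤ := (normSq_lt_top L hcoreA.contDiff.continuous).ne
  have hCtop : C ≠ ⊤ := (normSq_lt_top L hcoreC.contDiff.continuous).ne
  -- stub 1 at `Φp` and at `Φm`, stub 2 at `Φm`
  obtain ⟨hid, hA0⟩ := h₁ v hv hb (n + 2) L hL Φp gp
  obtain ⟨-, hAm0⟩ := h₁ v hv hb n L hL Φm gm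
  obtain ⟨hAmC, hadd⟩ := h₂ v hv hb n L hL Φm gm
  have hC0 : C ≠ 0 := fun h => hAm0 (le_zero_iff.1 (h ▸ hAmC))
  -- stubs 3 and 4 at `(Φm, Φp)`
  have h3 : Km / Am ≤ Kp / A + τ := hn₃ n hn3 Φm Φp gm gp
  have h4 : Dn ≤ τ * C := hn₄ n hn4 Φm gm
  -- variational principle for the two core functions, at particle number `n + 2`
  have hvarA : E2 * A ≤ qform v L (condAn L Φp.ψ) := groundStateEnergy_mul_normSq_le hL hv.1 hcoreA
  have hvarC : E2 * C ≤ qform v L (condCr L Φm.ψ) := groundStateEnergy_mul_normSq_le hL hv.1 hcoreC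
  -- removal side: `E2 + Kp/A ≤ E3`
  have hrem : E2 + Kp / A ≤ E3 := by
    have h : E2 * A + Kp ≤ E3 * A :=
      calc E2 * A + Kp ≤ qform v L (condAn L Φp.ψ) + Kp := add_le_add hvarA le_rfl
        _ = E3 * A := hid
    rw [← ENNReal.mul_le_mul_iff_left hA0 hAtop, add_mul, ENNReal.div_mul_cancel hA0 hAtop]
    exact h
  -- addition side: `E2 ≤ E1 + Km/C + Dn/C`
  have haddside : E2 ≤ E1 + Km / C + Dn / C := by
    have h : E2 * C ≤ E1 * C + Km + Dn := hvarC.trans hadd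
    rw [← ENNReal.mul_le_mul_iff_left hC0 hCtop, add_mul, add_mul, ENNReal.div_mul_cancel hC0 hCtop,
      ENNReal.div_mul_cancel hC0 hCtop]
    exact h
  -- CCR + stub 3: `Km/C ≤ Km/Am ≤ Kp/A + τ`; stub 4: `Dn/C ≤ τ`
  have hKC : Km / C ≤ Kp / A + τ := (ENNReal.div_le_div_left hAmC Km).trans h3
  have hDC : Dn / C ≤ τ := ENNReal.div_le_of_le_mul h4
  have hadd' : E2 ≤ E1 + (Kp / A + τ) + τ :=
    haddside.trans (add_le_add (add_le_add le_rfl hKC) hDC)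
  -- finiteness of `Kp/A` and the sum
  have hKAtop : Kp / A ≠ ⊤ := ne_top_of_le_ne_top hΦp_t (le_add_self.trans hrem)
  have hsum : 2 * E2 + Kp / A ≤ E3 + E1 + (τ + τ) + Kp / A :=
    calc 2 * E2 + Kp / A = (E2 + Kp / A) + E2 := by rw [two_mul]; ring
      _ ≤ E3 + (E1 + (Kp / A + τ) + τ) := add_le_add hrem hadd'
      _ = E3 + E1 + (τ + τ) + Kp / A := by ring
  have hmain : 2 * E2 ≤ E3 + E1 + (τ + τ) := ENNReal.le_of_add_le_add_right hKAtop hsum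
  -- tolerance `τ + τ = κ(2π/L)²` and the shape of the crux at `N = n + 2`
  have hττ : τ + τ = ENNReal.ofReal (κ * (2 * Real.pi / L) ^ 2) := by
    rw [hτ, ← ENNReal.ofReal_add (by positivity) (by positivity)]
    congr 1
    ring
  have e1 : n + 2 - 1 = n + 1 := rfl
  rw [e1, ← hττ]
  exact hmain

end Summit.AtomisticToContinuum.BoseEinsteinCondensation.Cruxes.NearConvexity.Birth

end
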